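import Summits.KontsevichZagierPeriods.KontsevichZagierPeriods.Theses.UnfoldedStokes
import Summits.KontsevichZagierPeriods.KontsevichZagierPeriods.Theorems.UnfoldedStokesCubeKernelStepStubSlabGluing
import Summits.KontsevichZagierPeriods.KontsevichZagierPeriods.Theorems.UnfoldedStokesCubeKernelStepStubFibreNullPolynomial
import Literature.NumberTheory.Transcendental.KZFibredRelations
import Literature.NumberTheory.Transcendental.KZConstantTerm
import Literature.NumberTheory.Transcendental.KZProductIdeal
import Literature.NumberTheory.Transcendental.KZLogCalculusProofs

/-!
# Line `three_sectors` — skeleton for crux `CubeKernelStep` (stmt-KontsevichZagierPeriods-17854)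

Crux-strategist `planner-cstrat-stmt-KontsevichZagierPeriods-17854-0`, 2026-08-17.

THE CRUX (route UnfoldedStokes, piece 3/3 of the BC2 split of `StokesGeneration`): for `d ≥ 1`,
IF every closed-cube representation of dimension `≤ d` with integrand continuous on the closed
cube and value `0` is a relation (`K(≤d)`), THEN so is every such representation of dimension
`d + 1`.

THE CUT. The registered line `Sketch` (lead) cuts the step over the parameter `s = z 0` into
K1 (fibre-null families are relations — FUNCTIONAL) and K2 = `stub_meanRealisation` (every
value-`0` family is congruent to a fibre-null one in the SAME dimension `d+1` — SPORADIC). This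
line keeps K1 verbatim (shared stub) and cuts K2 along the one further seam that is visible in
the calculus' own algebra — the Fubini PRODUCT (`KZ.IntegralRep.prod`, `relations` a two-sided
ideal, `KZProductIdeal`): 

* `stub_productSector` (P, the QUADRATIC sector; open, classical): under `K(≤d)`, a value-`0`
  representation on the closed `(d+1)`-cube whose integrand is SEPARATED over the parameter,
  `Σ_{j<n} c_j(z 0) · h_j(tail z)` with `c_j`, `h_j` continuous integrands of closed `1`- and
  `d`-cube representations, is a relation. By `K(≤1)`, `K(≤d)` and `K`-bilinear reduction
  (`K = ℚ̄ ∩ ℝ`) this is exactly "every `K`-bilinear relation between `1`-periods and `d`-periods,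
  `ker (P₁ ⊗_K P_d → ℝ)`, is a chain"; at `d = 1` it is the Sym²-layer of `1`-periods —
  Legendre's relation, Riemann's bilinear relations with correspondences, quadratic Γ/Beta
  identities — i.e. Grothendieck's period conjecture in DEGREE TWO for (products of) 1-motives
  (Bertolin 2002; Huber–Wüstholz 2022 Prologue), strictly below GPC weight 2, and the home of
  THIS ROUTE's engine and landed theorems (`UnfoldedStokesSquare`, `LegendreCubicForm`,
  `HyperellipticRiemannRelation`, `LegendreAllModuli`; rank one LANDED as
  `Layers.stub_separatedRankOne`).
* `stub_residualReduction` (R, the honest non-product sporadic core; open): under `K(≤d)`, every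
  value-`0` continuous closed `(d+1)`-cube representation is congruent modulo `relations` to the
  SUM of a fibre-null continuous family and a separated one, BOTH IN DIMENSION `d+1`. R is weaker
  than K2 (K2 is R with `t_sep = 0`) and weaker than "reduction to separated form" (R with
  `t' = 0`); its first instances at `d = 1` are `ζ(2) = π²/6` (Calabi substitution), dilogarithm
  ladders (K1 for the differentiated functional equation + one Newton–Leibniz move ALONG THE
  PARAMETER), `∫₀¹ K(k) dk = 2G` (transposition makes the marginal tame).

Composition `cubeKernelStep_of_sectors` (real proof): R splits `[t] ≡ [t'] + [t_sep]`; K1 at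
every `s₀`, a Lebesgue number and slab gluing (LANDED, imported: `Layers.stub_slabGluing`) kill
`[t']`; soundness (`relations_le_ker_eval_holds`) then gives `t_sep.value = 0`, and P kills
`[t_sep]`. `CubeKernelStep_of_stubs` concludes the ROUTE DECL by name. A second composition
`meanRealisation_of_sectors : P → R → (Sketch's K2)` (real proof, Fubini + soundness) makes this file also
a line for the child `MeanRealisation` of the s1 split packet (`SPLIT-FILING.md`), should it be filed.

DIMENSION BUDGET (strategist calibration, STRATEGY-CENSUS.md §Decomposition Δ-budget): K2 with
`t'` allowed in dimension `2d+1` is TRIVIAL (`t'(s,x,y) := t(s,x) − t(s,y) + t(y,x…)`), so the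
dimension `d+1` of `t'`, `t_sep` in R and the fibre dimension `d` in K1 are load-bearing and are
kept fixed here.

RUNG stubs (registered beside the composition, each provable now, none used by it):
* `stub_primitiveCompression` (M, unconditional): `[□², s (s − s x)^k w(s x)] ≡ [[0,1],
  (1 − u)^{k+1} w(u) / (k+1)]` — shear `u = s x` (fibred rule 2), transposition (rule 2), one
  Newton–Leibniz move along `s` (rule 3, polynomial primitive). The POSITIVE form of the
  Disproof's `SecondWindow` mechanism (`hasSADeriv_marginal_of_mem`): it is the chain by which
  every marginal with a semialgebraic `(k+1)`-st derivative is realised and removed; `k = 0` is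
  the `sqRep` chain of Disproof §E3.
* `stub_derivativeMarginal` (L; a K2-instance = R with `t_sep` rational-coefficient): under
  `K(≤d)`, if the marginal `V = sliceValue t` has a continuous `ℚ`-semialgebraic derivative `w` on
  `[0,1]`, then `t ≡ t'` fibre-null in dimension `d+1`: `t' := t − t(0,·) − s·w(s·z₁)`; the
  leftover `[□^d, t(0,·)] + [[0,1], (1−u) w(u)]` has value `V(0) − V(0) = 0` and dimension `≤ d`.
* `stub_separatedRankTwoAlgebraic` (M; card kunneth-peel's first lemma, P at rank two with an
  algebraic ratio): `∫f₁ = ρ ∫f₂`, `∫g₂ = −ρ ∫g₁`, `ρ` real algebraic ⇒ `[f₁][g₁] + [f₂][g₂] ∈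
  relations` under `K(≤1)` — `K(≤d)` used TWICE through the ideal.

Sorries: exactly the six stubs. Every stub signature is self-contained over tree vocabulary
(`KZ.IntegralRep`, `KZ.of`, `KZ.relations`, `KZ.sliceValue`, `KZ.IntegralRep.slabRestrict`,
`IsSemialgebraicFunOn`, Mathlib), so each can be stated verbatim in a `Theorems/` file.
-/

noncomputable section

set_option linter.dupNamespace false

namespace Summit.KontsevichZagierPeriods.KontsevichZagierPeriods.Cruxes.CubeKernelStep.ThreeSectors

open MeasureTheory Set Filter Metric
open scoped Topology BigOperators
open Literature.NumberTheory.Transcendental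
open Literature.NumberTheory.Transcendental.KZ
open Summit.KontsevichZagierPeriods.KontsevichZagierPeriods.Theses.UnfoldedStokes (CubeKernelStep)

/-! ## Composition stubs -/

/-- STUB K1 (`open`, functional; SHARED VERBATIM with line `Sketch`): **fibre-null germs are
relations.** Under `K(≤d)`, a continuous closed `(d+1)`-cube representation all of whose slice
values over `z 0` vanish is a relation on every small enough rational slab around every
parameter value `s₀ ∈ [0,1]` (Ayoub's relative injectivity + accessibility of fibred relations;
the lower layers enter through the two-sided ideal `KZ.relations`). Implied by the summit. -/
theorem stub_fibreNullGerm :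
    ∀ d : ℕ, 1 ≤ d →
      (∀ (M : ℕ), M ≤ d → ∀ (a : IntegralRep M),
        a.domain = Set.pi Set.univ (fun _ : Fin M => Set.Icc (0:ℝ) 1) →
        ContinuousOn a.integrand a.domain → a.value = 0 → of a ∈ relations) →
      ∀ (t : IntegralRep (d + 1)),
        t.domain = Set.pi Set.univ (fun _ : Fin (d + 1) => Set.Icc (0:ℝ) 1) →
        ContinuousOn t.integrand t.domain →
        (∀ s ∈ Set.Icc (0:ℝ) 1, sliceValue t s = 0) →
        ∀ s₀ ∈ Set.Icc (0:ℝ) 1, ∃ ε : ℝ, 0 < ε ∧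
          ∀ a b : ℚ, s₀ - ε ≤ (a : ℝ) → (a : ℝ) < b → (b : ℝ) ≤ s₀ + ε →
            of (t.slabRestrict a b) ∈ relations := by
  sorry

/-- STUB P (`open`, classical: Grothendieck's period conjecture in degree two for 1-motives at
`d = 1`; the `(1,d)`-Künneth sector in general): **the product sector.** Under `K(≤d)` (`d ≥ 1`),
a representation on the closed `(d+1)`-cube whose integrand is, on the cube, the separated sum
`Σ_{j<n} c_j(z 0) · h_j(tail z)` of products of continuous integrands of closed `1`-cube
representations `c j` and closed `d`-cube representations `h j`, and whose value is `0`, is a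
relation. Rank one is LANDED (`Layers.stub_separatedRankOne`); the algebraic-ratio rank-two case
is the rung `stub_separatedRankTwoAlgebraic`; the route's `LegendreCubicForm`,
`HyperellipticRiemannRelation`, `LegendreAllModuli` are instances with transcendental ratios.
Implied by the summit; does not imply the crux (non-separated kernel elements, e.g. dilogarithm
identities, are not in its scope). -/
theorem stub_productSector :
    ∀ d : ℕ, 1 ≤ d →
      (∀ (M : ℕ), M ≤ d → ∀ (a : IntegralRep M),
        a.domain = Set.pi Set.univ (fun _ : Fin M => Set.Icc (0:ℝ) 1) →
        ContinuousOn a.integrand a.domain → a.value = 0 → of a ∈ relations) →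
      ∀ (n : ℕ) (c : Fin n → IntegralRep 1) (h : Fin n → IntegralRep d) (t : IntegralRep (d + 1)),
        (∀ j, (c j).domain = Set.pi Set.univ (fun _ : Fin 1 => Set.Icc (0:ℝ) 1)) →
        (∀ j, ContinuousOn (c j).integrand (c j).domain) →
        (∀ j, (h j).domain = Set.pi Set.univ (fun _ : Fin d => Set.Icc (0:ℝ) 1)) →
        (∀ j, ContinuousOn (h j).integrand (h j).domain) →
        t.domain = Set.pi Set.univ (fun _ : Fin (d + 1) => Set.Icc (0:ℝ) 1) →
        Set.EqOn t.integrand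
          (fun z => ∑ j, (c j).integrand (fun _ : Fin 1 => z 0) * (h j).integrand (Fin.tail z))
          t.domain →
        t.value = 0 → of t ∈ relations := by
  sorry

/-- STUB R (`open`, the non-product sporadic core): **residual reduction.** Under `K(≤d)`
(`d ≥ 1`), every continuous closed `(d+1)`-cube representation of value `0` is congruent modulo
`KZ.relations` to the sum of a continuous FIBRE-NULL closed `(d+1)`-cube representation `t'`
(all slice values over `z 0` vanish) and a SEPARATED closed `(d+1)`-cube representation `tsep`
(integrand `Σ_{j<n} c_j(z 0) · h_j(tail z)` as in `stub_productSector`). Weaker than line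
`Sketch`'s `stub_meanRealisation` (= the case `n = 0`); implied by the summit (`t' = tsep = 0`);
gives the crux only together with K1 and P. Both `t'` and `tsep` stay in dimension `d + 1`
(dimension budget). -/
theorem stub_residualReduction :
    ∀ d : ℕ, 1 ≤ d →
      (∀ (M : ℕ), M ≤ d → ∀ (a : IntegralRep M),
        a.domain = Set.pi Set.univ (fun _ : Fin M => Set.Icc (0:ℝ) 1) →
        ContinuousOn a.integrand a.domain → a.value = 0 → of a ∈ relations) →
      ∀ (t : IntegralRep (d + 1)),
        t.domain = Set.pi Set.univ (fun _ : Fin (d + 1) => Set.Icc (0:ℝ) 1) →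
        ContinuousOn t.integrand t.domain → t.value = 0 →
        ∃ (t' : IntegralRep (d + 1)) (n : ℕ) (c : Fin n → IntegralRep 1) (h : Fin n → IntegralRep d)
          (tsep : IntegralRep (d + 1)),
          t'.domain = Set.pi Set.univ (fun _ : Fin (d + 1) => Set.Icc (0:ℝ) 1) ∧
          ContinuousOn t'.integrand t'.domain ∧
          (∀ s ∈ Set.Icc (0:ℝ) 1, sliceValue t' s = 0) ∧
          (∀ j, (c j).domain = Set.pi Set.univ (fun _ : Fin 1 => Set.Icc (0:ℝ) 1)) ∧
          (∀ j, ContinuousOn (c j).integrand (c j).domain) ∧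
          (∀ j, (h j).domain = Set.pi Set.univ (fun _ : Fin d => Set.Icc (0:ℝ) 1)) ∧
          (∀ j, ContinuousOn (h j).integrand (h j).domain) ∧
          tsep.domain = Set.pi Set.univ (fun _ : Fin (d + 1) => Set.Icc (0:ℝ) 1) ∧
          Set.EqOn tsep.integrand
            (fun z => ∑ j, (c j).integrand (fun _ : Fin 1 => z 0) * (h j).integrand (Fin.tail z))
            tsep.domain ∧
          of t - of t' - of tsep ∈ relations := by
  sorry

/-! ## Rung stubs (special cases; not used by the composition) -/

/-- RUNG (provable now, M; unconditional): **compression of an iterated primitive.** For `w`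
continuous and `ℚ`-semialgebraic on `[0,1]` and `k : ℕ`, the closed-square representation with
integrand `s · (s − s·x)^k · w(s·x)` (coordinates `s = z 0`, `x = z 1`) is KZ-equivalent to the
closed-interval representation with integrand `(1 − u)^{k+1} · w(u) / (k+1)`. Chain: the fibred
shear `(s,x) ↦ (s, u = s x)` (rule 2, Jacobian `s`, injective on the open square; faces are null)
onto `{0 < u < s < 1}` with integrand `(s − u)^k w(u)`; the transposition `(s,u) ↦ (u,s)` (rule 2);
one Newton–Leibniz move along the now-last coordinate `s ∈ [u,1]` over the base `u ∈ [0,1]`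
with the POLYNOMIAL-in-`s` primitive `(s − u)^{k+1} w(u)/(k+1)` (rule 3). Its marginal over `s`
is the `(k+1)`-fold primitive of `w`: this is the chain behind every "tame marginal" reduction
(Disproof `SecondWindow` read positively; `k = 0` is the `sqRep` chain of Disproof §E3). -/
theorem stub_primitiveCompression :
    ∀ (k : ℕ) (w : (Fin 1 → ℝ) → ℝ),
      ContinuousOn w (Set.pi Set.univ (fun _ : Fin 1 => Set.Icc (0:ℝ) 1)) →
      IsSemialgebraicFunOn ℚ (Set.pi Set.univ (fun _ : Fin 1 => Set.Icc (0:ℝ) 1)) w →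
      ∀ (r : IntegralRep 2) (r₁ : IntegralRep 1),
        r.domain = Set.pi Set.univ (fun _ : Fin 2 => Set.Icc (0:ℝ) 1) →
        Set.EqOn r.integrand
          (fun z => z 0 * (z 0 - z 0 * z 1) ^ k * w (fun _ : Fin 1 => z 0 * z 1)) r.domain →
        r₁.domain = Set.pi Set.univ (fun _ : Fin 1 => Set.Icc (0:ℝ) 1) →
        Set.EqOn r₁.integrand
          (fun u => (1 - u 0) ^ (k + 1) / ((k : ℝ) + 1) * w u) r₁.domain →
        of r - of r₁ ∈ relations := by
  sorry

/-- RUNG (provable now, L; a K2-instance, equivalently R with a rational-coefficient separated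
part): **a marginal with a semialgebraic derivative is realised and removed inside dimension
`d+1`.** Under `K(≤d)` (`d ≥ 1`): if `t` is a continuous closed `(d+1)`-cube representation of
value `0` whose marginal `V = sliceValue t` has, within `[0,1]`, a derivative `w` that is
continuous and `ℚ`-semialgebraic on `[0,1]`, then `t` is congruent modulo `relations` to a
continuous fibre-null closed `(d+1)`-cube representation. Witness:
`t'(z) := t(z) − t(update z 0 0) − z 0 · w(z 0 · z 1)` (slices `V(s) − V(0) − ∫₀ˢ w = 0`); the
difference `[t] − [t']` is, by integrand additivity, silent-variable removal and
`stub_primitiveCompression` (`k = 0`), congruent to `[□^d, t(0,·)] + [[0,1], (1−u) w(u)]`, a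
combination of dimension `≤ d` and value `V(0) + (−V(0)) = 0` (FTC), killed by `K(≤d)` after
merging on the `d`-cube. This is the exact converse of the Disproof's invariant
`hasSADeriv_marginal_of_mem`: semialgebraic-derivative marginals are precisely the K2-trivial
ones modulo `K(≤d)`. -/
theorem stub_derivativeMarginal :
    ∀ d : ℕ, 1 ≤ d →
      (∀ (M : ℕ), M ≤ d → ∀ (a : IntegralRep M),
        a.domain = Set.pi Set.univ (fun _ : Fin M => Set.Icc (0:ℝ) 1) →
        ContinuousOn a.integrand a.domain → a.value = 0 → of a ∈ relations) →
      ∀ (t : IntegralRep (d + 1)) (w : (Fin 1 → ℝ) → ℝ),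
        t.domain = Set.pi Set.univ (fun _ : Fin (d + 1) => Set.Icc (0:ℝ) 1) →
        ContinuousOn t.integrand t.domain → t.value = 0 →
        ContinuousOn w (Set.pi Set.univ (fun _ : Fin 1 => Set.Icc (0:ℝ) 1)) →
        IsSemialgebraicFunOn ℚ (Set.pi Set.univ (fun _ : Fin 1 => Set.Icc (0:ℝ) 1)) w →
        (∀ s ∈ Set.Icc (0:ℝ) 1,
          HasDerivWithinAt (sliceValue t) (w (fun _ : Fin 1 => s)) (Set.Icc (0:ℝ) 1) s) →
        ∃ t' : IntegralRep (d + 1),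
          t'.domain = Set.pi Set.univ (fun _ : Fin (d + 1) => Set.Icc (0:ℝ) 1) ∧
          ContinuousOn t'.integrand t'.domain ∧
          (∀ s ∈ Set.Icc (0:ℝ) 1, sliceValue t' s = 0) ∧
          of t - of t' ∈ relations := by
  sorry

/-- RUNG (provable now, M; card kunneth-peel's first lemma — P at rank two with an algebraic
ratio): under `K(≤1)`, if `f₁ f₂ g₁ g₂` are continuous closed-interval representations with
`∫f₁ = ρ ∫f₂` and `∫g₂ = −ρ ∫g₁` for a real algebraic `ρ`, then `[f₁]·[g₁] + [f₂]·[g₂]` is a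
relation: `[f₁][g₁] + [f₂][g₂] = ([f₁] − ρ[f₂])[g₁] + [f₂](ρ[g₁] + [g₂])` with both brackets
realised by value-`0` continuous interval representations (integrands `f₁ − ρ f₂`, `ρ g₁ + g₂`),
killed by `K(≤1)`, and `relations` a two-sided ideal (`mul_mem_relations_left/right_holds`). The
CM square `K(1/√2)² = ϖ²/2` is of this kind. -/
theorem stub_separatedRankTwoAlgebraic :
    (∀ (a : IntegralRep 1), a.domain = Set.pi Set.univ (fun _ : Fin 1 => Set.Icc (0:ℝ) 1) →
        ContinuousOn a.integrand a.domain → a.value = 0 → of a ∈ relations) →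
      ∀ (ρ : ℝ), IsAlgebraic ℚ ρ →
        ∀ (f₁ f₂ g₁ g₂ : IntegralRep 1),
          f₁.domain = Set.pi Set.univ (fun _ : Fin 1 => Set.Icc (0:ℝ) 1) →
          f₂.domain = Set.pi Set.univ (fun _ : Fin 1 => Set.Icc (0:ℝ) 1) →
          g₁.domain = Set.pi Set.univ (fun _ : Fin 1 => Set.Icc (0:ℝ) 1) →
          g₂.domain = Set.pi Set.univ (fun _ : Fin 1 => Set.Icc (0:ℝ) 1) →
          ContinuousOn f₁.integrand f₁.domain → ContinuousOn f₂.integrand f₂.domain →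
          ContinuousOn g₁.integrand g₁.domain → ContinuousOn g₂.integrand g₂.domain →
          f₁.value = ρ * f₂.value → g₂.value = -ρ * g₁.value →
          of f₁ * of g₁ + of f₂ * of g₂ ∈ relations := by
  sorry

/-! ## The composition (real proof) -/

/-- **Lebesgue-number step** (verbatim the lemma of `Lines/Sketch.lean`, kernel-checked there). If
around every parameter `s₀ ∈ [0,1]` all small rational slabs of a family are relations, then for
some `N ≥ 1` every slab of the rational equipartition of mesh `1/N` is a relation. -/
theorem exists_equipartition_of_germs {d : ℕ} (t : IntegralRep (d + 1))
    (hgerm : ∀ s₀ ∈ Set.Icc (0:ℝ) 1, ∃ ε : ℝ, 0 < ε ∧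
      ∀ a b : ℚ, s₀ - ε ≤ (a : ℝ) → (a : ℝ) < b → (b : ℝ) ≤ s₀ + ε →
        of (t.slabRestrict a b) ∈ relations) :
    ∃ N : ℕ, 0 < N ∧
      ∀ k : ℕ, k < N → of (t.slabRestrict ((k : ℚ) / N) (((k : ℚ) + 1) / N)) ∈ relations := by
  classical
  choose! ε hε hslab using hgerm
  obtain ⟨δ, hδ, hcov⟩ := lebesgue_number_lemma_of_metric (ι := Set.Icc (0:ℝ) 1) isCompact_Icc
    (c := fun i => ball (i : ℝ) (ε i)) (fun _ => isOpen_ball)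
    (fun x hx => Set.mem_iUnion.mpr ⟨⟨x, hx⟩, mem_ball_self (hε x hx)⟩)
  obtain ⟨N, hN⟩ := exists_nat_one_div_lt hδ
  refine ⟨N + 1, Nat.succ_pos N, fun k hk => ?_⟩
  have hNpos : (0:ℝ) < (N + 1 : ℕ) := by exact_mod_cast Nat.succ_pos N
  have hk' : (k : ℝ) ≤ N := by exact_mod_cast Nat.lt_succ_iff.mp hk
  set x : ℝ := (k : ℝ) / (N + 1 : ℕ) with hx
  have hx0 : 0 ≤ x := div_nonneg (Nat.cast_nonneg k) hNpos.le
  have hx1 : x ≤ 1 := by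
    rw [hx, div_le_one hNpos]
    push_cast
    linarith
  obtain ⟨⟨s₀, hs₀⟩, hball⟩ := hcov x ⟨hx0, hx1⟩
  have hmesh : (1:ℝ) / (N + 1 : ℕ) < δ := by
    simpa using hN
  have hxs : x ∈ ball s₀ (ε s₀) := hball (mem_ball_self hδ)
  have hys : x + 1 / (N + 1 : ℕ) ∈ ball s₀ (ε s₀) := by
    refine hball ?_
    rw [mem_ball, Real.dist_eq, add_sub_cancel_left, abs_of_pos (by positivity)]
    exact hmesh
  rw [mem_ball, Real.dist_eq, abs_lt] at hxs hys
  refine hslab s₀ hs₀ _ _ ?_ ?_ ?_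
  · have : (((k : ℚ) / (N + 1 : ℕ) : ℚ) : ℝ) = x := by rw [hx]; push_cast; ring
    rw [this]; linarith [hxs.1]
  · push_cast
    exact div_lt_div_of_pos_right (by linarith) (by exact_mod_cast Nat.succ_pos N)
  · have : ((((k : ℚ) + 1) / (N + 1 : ℕ) : ℚ) : ℝ) = x + 1 / (N + 1 : ℕ) := by
      rw [hx]; push_cast; ring
    rw [this]; linarith [hys.2]

/-- **`CubeKernelStep` from the three sector stubs** (K1-germ, P, R) and slab gluing. -/
theorem cubeKernelStep_of_sectors
    (h1 : ∀ d : ℕ, 1 ≤ d →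
      (∀ (M : ℕ), M ≤ d → ∀ (a : IntegralRep M),
        a.domain = Set.pi Set.univ (fun _ : Fin M => Set.Icc (0:ℝ) 1) →
        ContinuousOn a.integrand a.domain → a.value = 0 → of a ∈ relations) →
      ∀ (t : IntegralRep (d + 1)),
        t.domain = Set.pi Set.univ (fun _ : Fin (d + 1) => Set.Icc (0:ℝ) 1) →
        ContinuousOn t.integrand t.domain →
        (∀ s ∈ Set.Icc (0:ℝ) 1, sliceValue t s = 0) →
        ∀ s₀ ∈ Set.Icc (0:ℝ) 1, ∃ ε : ℝ, 0 < ε ∧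
          ∀ a b : ℚ, s₀ - ε ≤ (a : ℝ) → (a : ℝ) < b → (b : ℝ) ≤ s₀ + ε →
            of (t.slabRestrict a b) ∈ relations)
    (hP : ∀ d : ℕ, 1 ≤ d →
      (∀ (M : ℕ), M ≤ d → ∀ (a : IntegralRep M),
        a.domain = Set.pi Set.univ (fun _ : Fin M => Set.Icc (0:ℝ) 1) →
        ContinuousOn a.integrand a.domain → a.value = 0 → of a ∈ relations) →
      ∀ (n : ℕ) (c : Fin n → IntegralRep 1) (h : Fin n → IntegralRep d) (t : IntegralRep (d + 1)),
        (∀ j, (c j).domain = Set.pi Set.univ (fun _ : Fin 1 => Set.Icc (0:ℝ) 1)) →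
        (∀ j, ContinuousOn (c j).integrand (c j).domain) →
        (∀ j, (h j).domain = Set.pi Set.univ (fun _ : Fin d => Set.Icc (0:ℝ) 1)) →
        (∀ j, ContinuousOn (h j).integrand (h j).domain) →
        t.domain = Set.pi Set.univ (fun _ : Fin (d + 1) => Set.Icc (0:ℝ) 1) →
        Set.EqOn t.integrand
          (fun z => ∑ j, (c j).integrand (fun _ : Fin 1 => z 0) * (h j).integrand (Fin.tail z))
          t.domain →
        t.value = 0 → of t ∈ relations)
    (hR : ∀ d : ℕ, 1 ≤ d →
      (∀ (M : ℕ), M ≤ d → ∀ (a : IntegralRep M),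
        a.domain = Set.pi Set.univ (fun _ : Fin M => Set.Icc (0:ℝ) 1) →
        ContinuousOn a.integrand a.domain → a.value = 0 → of a ∈ relations) →
      ∀ (t : IntegralRep (d + 1)),
        t.domain = Set.pi Set.univ (fun _ : Fin (d + 1) => Set.Icc (0:ℝ) 1) →
        ContinuousOn t.integrand t.domain → t.value = 0 →
        ∃ (t' : IntegralRep (d + 1)) (n : ℕ) (c : Fin n → IntegralRep 1) (h : Fin n → IntegralRep d)
          (tsep : IntegralRep (d + 1)),
          t'.domain = Set.pi Set.univ (fun _ : Fin (d + 1) => Set.Icc (0:ℝ) 1) ∧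
          ContinuousOn t'.integrand t'.domain ∧
          (∀ s ∈ Set.Icc (0:ℝ) 1, sliceValue t' s = 0) ∧
          (∀ j, (c j).domain = Set.pi Set.univ (fun _ : Fin 1 => Set.Icc (0:ℝ) 1)) ∧
          (∀ j, ContinuousOn (c j).integrand (c j).domain) ∧
          (∀ j, (h j).domain = Set.pi Set.univ (fun _ : Fin d => Set.Icc (0:ℝ) 1)) ∧
          (∀ j, ContinuousOn (h j).integrand (h j).domain) ∧
          tsep.domain = Set.pi Set.univ (fun _ : Fin (d + 1) => Set.Icc (0:ℝ) 1) ∧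
          Set.EqOn tsep.integrand
            (fun z => ∑ j, (c j).integrand (fun _ : Fin 1 => z 0) * (h j).integrand (Fin.tail z))
            tsep.domain ∧
          of t - of t' - of tsep ∈ relations)
    (h3 : ∀ (d : ℕ) (t : IntegralRep (d + 1)),
      t.domain = Set.pi Set.univ (fun _ : Fin (d + 1) => Set.Icc (0:ℝ) 1) →
      ∀ N : ℕ, 0 < N →
        (∀ k : ℕ, k < N → of (t.slabRestrict ((k : ℚ) / N) (((k : ℚ) + 1) / N)) ∈ relations) →
        of t ∈ relations) :
    ∀ d : ℕ, 1 ≤ d →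
      (∀ (M : ℕ), M ≤ d → ∀ (t : IntegralRep M),
        t.domain = Set.pi Set.univ (fun _ : Fin M => Set.Icc (0:ℝ) 1) →
        ContinuousOn t.integrand t.domain → t.value = 0 → of t ∈ relations) →
      ∀ (t : IntegralRep (d + 1)),
        t.domain = Set.pi Set.univ (fun _ : Fin (d + 1) => Set.Icc (0:ℝ) 1) →
        ContinuousOn t.integrand t.domain → t.value = 0 → of t ∈ relations := by
  intro d hd hLE t htd htc hval
  -- R: split off a fibre-null family `t'` and a separated representation `tsep`
  obtain ⟨t', n, c, h, tsep, ht'd, ht'c, ht'n, hcd, hcc, hhd, hhc, hsd, hsi, hrel⟩ :=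
    hR d hd hLE t htd htc hval
  -- K1 at every parameter, a Lebesgue number, slab gluing: `[t']` is a relation
  obtain ⟨N, hN, hk⟩ := exists_equipartition_of_germs t' (h1 d hd hLE t' ht'd ht'c ht'n)
  have ht' : of t' ∈ relations := h3 d t' ht'd N hN hk
  -- soundness: `tsep` has value `0`
  have hsound : ∀ x : FormalRep, x ∈ relations → eval x = 0 := by
    intro x hx
    have hle : relations ≤ eval.ker := relations_le_ker_eval_holds
    exact AddMonoidHom.mem_ker.mp (hle hx)
  have hsep_val : tsep.value = 0 := by
    have e1 := hsound _ hrel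
    have e2 := hsound _ ht'
    simp only [map_sub, eval_of] at e1 e2
    linarith
  -- P kills the separated part
  have hsep : of tsep ∈ relations := hP d hd hLE n c h tsep hcd hcc hhd hhc hsd hsi hsep_val
  have e : of t = (of t - of t' - of tsep) + of t' + of tsep := by abel
  rw [e]
  exact relations.add_mem (relations.add_mem hrel ht') hsep

/-- **Line `Sketch`'s K2 (`stub_meanRealisation`; = child `MeanRealisation` of the s1 split packet
`SPLIT-FILING.md`) from R and P alone** — so `three_sectors` is at the same time a line for that child:
R splits `[t] ≡ [t'] + [tsep]`; `t'` is fibre-null hence of value `0` (Fubini,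
`Layers.value_eq_zero_of_sliceValue_eq_zero`, LANDED); soundness gives `tsep.value = 0`; P kills `[tsep]`;
the witness is `t'`. K1 is not used. -/
theorem meanRealisation_of_sectors
    (hP : ∀ d : ℕ, 1 ≤ d →
      (∀ (M : ℕ), M ≤ d → ∀ (a : IntegralRep M),
        a.domain = Set.pi Set.univ (fun _ : Fin M => Set.Icc (0:ℝ) 1) →
        ContinuousOn a.integrand a.domain → a.value = 0 → of a ∈ relations) →
      ∀ (n : ℕ) (c : Fin n → IntegralRep 1) (h : Fin n → IntegralRep d) (t : IntegralRep (d + 1)),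
        (∀ j, (c j).domain = Set.pi Set.univ (fun _ : Fin 1 => Set.Icc (0:ℝ) 1)) →
        (∀ j, ContinuousOn (c j).integrand (c j).domain) →
        (∀ j, (h j).domain = Set.pi Set.univ (fun _ : Fin d => Set.Icc (0:ℝ) 1)) →
        (∀ j, ContinuousOn (h j).integrand (h j).domain) →
        t.domain = Set.pi Set.univ (fun _ : Fin (d + 1) => Set.Icc (0:ℝ) 1) →
        Set.EqOn t.integrand
          (fun z => ∑ j, (c j).integrand (fun _ : Fin 1 => z 0) * (h j).integrand (Fin.tail z))
          t.domain →
        t.value = 0 → of t ∈ relations)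
    (hR : ∀ d : ℕ, 1 ≤ d →
      (∀ (M : ℕ), M ≤ d → ∀ (a : IntegralRep M),
        a.domain = Set.pi Set.univ (fun _ : Fin M => Set.Icc (0:ℝ) 1) →
        ContinuousOn a.integrand a.domain → a.value = 0 → of a ∈ relations) →
      ∀ (t : IntegralRep (d + 1)),
        t.domain = Set.pi Set.univ (fun _ : Fin (d + 1) => Set.Icc (0:ℝ) 1) →
        ContinuousOn t.integrand t.domain → t.value = 0 →
        ∃ (t' : IntegralRep (d + 1)) (n : ℕ) (c : Fin n → IntegralRep 1) (h : Fin n → IntegralRep d)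
          (tsep : IntegralRep (d + 1)),
          t'.domain = Set.pi Set.univ (fun _ : Fin (d + 1) => Set.Icc (0:ℝ) 1) ∧
          ContinuousOn t'.integrand t'.domain ∧
          (∀ s ∈ Set.Icc (0:ℝ) 1, sliceValue t' s = 0) ∧
          (∀ j, (c j).domain = Set.pi Set.univ (fun _ : Fin 1 => Set.Icc (0:ℝ) 1)) ∧
          (∀ j, ContinuousOn (c j).integrand (c j).domain) ∧
          (∀ j, (h j).domain = Set.pi Set.univ (fun _ : Fin d => Set.Icc (0:ℝ) 1)) ∧
          (∀ j, ContinuousOn (h j).integrand (h j).domain) ∧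
          tsep.domain = Set.pi Set.univ (fun _ : Fin (d + 1) => Set.Icc (0:ℝ) 1) ∧
          Set.EqOn tsep.integrand
            (fun z => ∑ j, (c j).integrand (fun _ : Fin 1 => z 0) * (h j).integrand (Fin.tail z))
            tsep.domain ∧
          of t - of t' - of tsep ∈ relations) :
    ∀ d : ℕ, 1 ≤ d →
      (∀ (M : ℕ), M ≤ d → ∀ (a : IntegralRep M),
        a.domain = Set.pi Set.univ (fun _ : Fin M => Set.Icc (0:ℝ) 1) →
        ContinuousOn a.integrand a.domain → a.value = 0 → of a ∈ relations) →
      ∀ (t : IntegralRep (d + 1)),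
        t.domain = Set.pi Set.univ (fun _ : Fin (d + 1) => Set.Icc (0:ℝ) 1) →
        ContinuousOn t.integrand t.domain → t.value = 0 →
        ∃ t' : IntegralRep (d + 1),
          t'.domain = Set.pi Set.univ (fun _ : Fin (d + 1) => Set.Icc (0:ℝ) 1) ∧
          ContinuousOn t'.integrand t'.domain ∧
          (∀ s ∈ Set.Icc (0:ℝ) 1, sliceValue t' s = 0) ∧
          of t - of t' ∈ relations := by
  intro d hd hLE t htd htc hval
  obtain ⟨t', n, c, h, tsep, ht'd, ht'c, ht'n, hcd, hcc, hhd, hhc, hsd, hsi, hrel⟩ :=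
    hR d hd hLE t htd htc hval
  have ht'v : t'.value = 0 :=
    Summit.KontsevichZagierPeriods.KontsevichZagierPeriods.Cruxes.CubeKernelStep.Layers.value_eq_zero_of_sliceValue_eq_zero
      t' ht'd ht'n
  have hsound : ∀ x : FormalRep, x ∈ relations → eval x = 0 := by
    intro x hx
    have hle : relations ≤ eval.ker := relations_le_ker_eval_holds
    exact AddMonoidHom.mem_ker.mp (hle hx)
  have hsep_val : tsep.value = 0 := by
    have e1 := hsound _ hrel
    simp only [map_sub, eval_of] at e1
    linarith
  have hsep : of tsep ∈ relations := hP d hd hLE n c h tsep hcd hcc hhd hhc hsd hsi hsep_val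
  refine ⟨t', ht'd, ht'c, ht'n, ?_⟩
  have e : of t - of t' = (of t - of t' - of tsep) + of tsep := by abel
  rw [e]
  exact relations.add_mem hrel hsep

/-- The registered composition: the crux's ROUTE DECL by name from the three sector stubs and
the LANDED slab gluing (`Layers.stub_slabGluing`, Theorems/UnfoldedStokesCubeKernelStepStubSlabGluing). -/
theorem CubeKernelStep_of_stubs : CubeKernelStep := by
  intro d hd hLE t htd htc hval
  exact cubeKernelStep_of_sectors stub_fibreNullGerm stub_productSector stub_residualReduction
    Summit.KontsevichZagierPeriods.KontsevichZagierPeriods.Cruxes.CubeKernelStep.Layers.stub_slabGluing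
    d hd hLE t htd htc hval

end Summit.KontsevichZagierPeriods.KontsevichZagierPeriods.Cruxes.CubeKernelStep.ThreeSectors

end
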